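import Mathlib
import Literature.NumberTheory.LFunctions.Zhang2022.TypedSection14
import Literature.NumberTheory.LFunctions.Zhang2022.Section14GaussSums
import Literature.NumberTheory.LFunctions.Zhang2022.Section5Lemma53
import Literature.NumberTheory.LFunctions.Zhang2022.Section3SigmaSplitting
import Literature.NumberTheory.LFunctions.Zhang2022.Section7MainTermAssembly
import Literature.NumberTheory.Sieve.BombieriAsymptoticSieveShiftedPrimes
import HarnessLib

/-!
# Zhang (2022) §14, node `Z22:§14.u013` (second `≪`): the majorant of the principal-character term
# is `≪ P𝓛ᶜ` — `Typed.Sec14.Step14u013b`, DISCHARGED (unconditionally, explicit `c = 845`)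

Topic `Literature/NumberTheory/LFunctions/Zhang2022` (Landau–Siegel audit tree; verdict-neutral).
Y. Zhang, *Discrete mean estimates and the Landau–Siegel zero*, arXiv:2211.02515v1 (2022)
[Zhang2022LandauSiegel], §14 p. 78 (tex L3928–L3930): "The total contribution from the `θ = ψ⁰_{Dk}`
term … is `≪ Σ_d d⁻¹ Σ_k Σ_l |κ*(dl)a*(dk)|/(φ(Dk)k)·|Δ(l/(Dpk))| ≪ P𝓛ᶜ`, by Lemma 5.3, which is
admissible for (14.5)" — **an unrefereed manuscript under adjudication**; nothing here asserts or
denies its Theorems 1–2, Proposition 14.1, or anything about Landau–Siegel zeros. Campaign D-0069,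
discharge lane (layer L3, seat d31). The statement `Step14u013b` (with the typed majorant
`major1413`) is L3-t7's (`TypedSection14.lean`), cited by name; the first `≪` of the same sentence
(`Step14u013a`) is sz-d46's `step14u013a_holds`; both are hypotheses of the landed deduction
`dedEq145_holds` of (14.5).

What is PROVED here (theorems only; no Assumption (A), no FACT-LIST input):

* `step14u013b_holds : Step14u013b` — for every `B`: `major1413 D p κ* a* ≤ C·P·𝓛⁸⁴⁵` for all large
  `D`, every `p ∼ P` and all `κ*, a*` subject to (14.1)–(14.2), with
  `C = 18·2¹⁷·B²·((2C₅₃⁺+3)·7¹⁶ + 4C₅₃⁺)`, `C₅₃⁺ = max(C₅₃,0)`, `C₅₃` the constant of the tree's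
  DISCHARGED Lemma 5.3 (`Skeleton.lemma53_holds`, `Section5Lemma53`). Route:
  `|κ*(dl)a*(dk)| ≤ B²τ₅(dl) ≤ B²d(d)⁴d(l)⁴` (`zeta_pow_five_le_card_divisors_pow_four`,
  `card_divisors_mul_le`); the **window lemma** `tsum_divisors_pow_mul_norm_DeltaW_le`:
  `Σ_l d(l)⁴|Δ(l/X)| ≤ ((2C+3)7¹⁶ + 4C)·X·𝓛⁶⁷⁴` for `1 ≤ X`, `log X ≤ 5𝓛⁹` — head `l ≤ Xt₀^{1.02}`
  by (5.8) (`‖Δ‖ ≤ 2C+3`, `norm_DeltaW_le_head`) and `Σ_{l≤Y} d(l)⁴ ≤ Y(1+log Y)¹⁶` (the tree's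
  `sum_card_divisors_pow_div_le_log_pow`), tail by (5.9): both exponents `(𝓛₂ log x/100)²` and
  `x^{0.99}/𝓛₂` exceed `6 log l` once `x = l/X > t₀^{1.02}` (`six_log_le_gaussLog`,
  `six_log_le_rpow_div`), so `d(l)⁴|Δ(l/X)| ≤ 2C/l²` (`divisors_pow_mul_norm_DeltaW_le_tail`) —
  applied at `X = Dpk` (`p < 2P`, `k ≤ 2P₄ ≤ P` by `Section14GaussSums.exists_two_mul_P4_le_bigP`);
  then `Dk/φ(Dk) ≤ (1 + log Dk)² ≤ 9𝓛¹⁸` (the tree's `Sieve.natCast_div_totient_le`),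
  `Σ_{k≤2P₄} 1/k ≤ 2𝓛⁹`, `Σ_{d≤2P₄} d(d)⁴/d ≤ 2¹⁶𝓛¹⁴⁴` (`majorant_sum_le`).

The exponent `845` is an artefact of crude polylog bookkeeping (e.g. `t₀^{1.02} ≤ 𝓛⁵³⁰`,
`(1 + log Y)¹⁶`); only "`P𝓛ᶜ` for some absolute `c`" is what the manuscript claims and uses.

## References

* Y. Zhang, arXiv:2211.02515v1 (2022), §14 p. 78 (u013); §5 Lemma 5.3 p. 25; §2 (2.6), (2.8)–(2.10).
  [cite: Zhang2022LandauSiegel, §14 u013 p.78]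
-/


noncomputable section

open Complex Real ComplexConjugate Finset

namespace Literature.NumberTheory.LFunctions.Zhang2022.Typed.Sec14

open Skeleton

/-! ## Arithmetic helpers: `τ₅ ≤ d⁴`, `d(mn) ≤ d(m)d(n)` -/

/-- `τ_{j+1}(n) ≤ d(n)^j`: the `(j+1)`-fold divisor function is at most the `j`-th power of the
divisor-counting function. [folklore] -/
private theorem zeta_pow_succ_apply_le_card_divisors_pow (j : ℕ) {n : ℕ} (hn : n ≠ 0) :
    (ArithmeticFunction.zeta ^ (j + 1) : ArithmeticFunction ℕ) n ≤ n.divisors.card ^ j := by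
  induction j generalizing n with
  | zero =>
      rw [zero_add, pow_one, ArithmeticFunction.zeta_apply, if_neg hn, pow_zero]
  | succ j ih =>
      rw [pow_succ, ArithmeticFunction.mul_zeta_apply]
      calc ∑ i ∈ n.divisors, (ArithmeticFunction.zeta ^ (j + 1) : ArithmeticFunction ℕ) i
          ≤ ∑ i ∈ n.divisors, n.divisors.card ^ j := by
            refine Finset.sum_le_sum fun i hi => ?_
            have hi0 : i ≠ 0 := Nat.pos_iff_ne_zero.mp (Nat.pos_of_mem_divisors hi)
            refine (ih hi0).trans (Nat.pow_le_pow_left ?_ j)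
            exact Finset.card_le_card (Nat.divisors_subset_of_dvd hn (Nat.dvd_of_mem_divisors hi))
        _ = n.divisors.card ^ (j + 1) := by rw [Finset.sum_const, smul_eq_mul, pow_succ']

/-- `τ₅(n) ≤ d(n)⁴` (as reals; trivially for `n = 0`). [folklore] -/
private theorem zeta_pow_five_le_card_divisors_pow_four (n : ℕ) :
    (((ArithmeticFunction.zeta ^ 5 : ArithmeticFunction ℕ) n : ℕ) : ℝ) ≤ (n.divisors.card : ℝ) ^ 4 := by
  rcases eq_or_ne n 0 with rfl | hn
  · simp
  · exact_mod_cast zeta_pow_succ_apply_le_card_divisors_pow 4 hn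

/-- `d(mn) ≤ d(m)d(n)` (every divisor of `mn` is a product of a divisor of `m` and one of `n`).
[folklore] -/
private theorem card_divisors_mul_le (m n : ℕ) : (m * n).divisors.card ≤ m.divisors.card * n.divisors.card := by
  rw [Nat.divisors_mul]
  exact Finset.card_mul_le

/-! ## The two exponent inequalities behind the tail of the `l`-series -/

/-- `log 2 ≥ 0.69`. [folklore] -/
private theorem log_two_ge : (0.69 : ℝ) ≤ Real.log 2 := by
  have := Real.log_two_gt_d9; linarith

/-- For `𝓛 ≥ 2` and `x ≥ 𝓛⁵¹⁹`: `log x ≥ 300`. [folklore] -/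
private theorem log_ge_of_ge_pow {L x : ℝ} (hL : 2 ≤ L) (hx : L ^ 519 ≤ x) : 300 ≤ Real.log x := by
  have hL0 : 0 < L := by linarith
  have hx0 : 0 < x := lt_of_lt_of_le (by positivity) hx
  have h1 : Real.log (L ^ 519) ≤ Real.log x := Real.log_le_log (by positivity) hx
  rw [Real.log_pow] at h1
  have h2 : Real.log 2 ≤ Real.log L := Real.log_le_log two_pos hL
  have h3 := log_two_ge
  push_cast at h1
  nlinarith

/-- **(T1)** For `𝓛 ≥ 2`, `x ≥ 𝓛⁵¹⁹`: `((𝓛⁴⁰⁰/100)·log x)² ≥ 6(log x + 5𝓛⁹)`. [cite: Zhang2022LandauSiegel, §5 (5.9)] -/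
theorem six_log_le_gaussLog {L x : ℝ} (hL : 2 ≤ L) (hx : L ^ 519 ≤ x) :
    6 * (Real.log x + 5 * L ^ 9) ≤ ((1 : ℝ) / 100 * L ^ 400 * Real.log x) ^ 2 := by
  have hlog := log_ge_of_ge_pow hL hx
  have hL1 : 1 ≤ L := by linarith
  have h791 : (2048 : ℝ) ≤ L ^ 791 := by
    calc (2048 : ℝ) = 2 ^ 11 := by norm_num
      _ ≤ L ^ 11 := pow_le_pow_left₀ (by norm_num) hL 11
      _ ≤ L ^ 791 := pow_le_pow_right₀ hL1 (by norm_num)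
  have h9 : (1 : ℝ) ≤ L ^ 9 := one_le_pow₀ hL1
  have hsplit : L ^ 800 = L ^ 9 * L ^ 791 := by rw [← pow_add]
  -- `(log x)² ≥ 300 log x`
  have hsq : 300 * Real.log x ≤ Real.log x ^ 2 := by nlinarith
  -- main chain
  have h1 : ((1 : ℝ) / 100 * L ^ 400 * Real.log x) ^ 2 = L ^ 800 * Real.log x ^ 2 / 10000 := by
    ring
  rw [h1, hsplit]
  rw [le_div_iff₀ (by norm_num : (0:ℝ) < 10000)]
  have hlx0 : 0 ≤ Real.log x := by linarith
  nlinarith [mul_le_mul_of_nonneg_left hsq (by positivity : (0:ℝ) ≤ L ^ 9 * L ^ 791),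
    mul_nonneg (sub_nonneg.mpr h791) hlx0, mul_nonneg (sub_nonneg.mpr h9) hlx0]

/-- **(T2)** For `𝓛 ≥ 2`, `x ≥ 𝓛⁵¹⁹`: `x^{0.99}/𝓛⁴⁰⁰ ≥ 6(log x + 5𝓛⁹)`. [cite: Zhang2022LandauSiegel, §5 (5.9)] -/
theorem six_log_le_rpow_div {L x : ℝ} (hL : 2 ≤ L) (hx : L ^ 519 ≤ x) :
    6 * (Real.log x + 5 * L ^ 9) ≤ x ^ (0.99 : ℝ) / L ^ 400 := by
  have hL0 : 0 < L := by linarith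
  have hL1 : 1 ≤ L := by linarith
  have hx0 : 0 < x := lt_of_lt_of_le (by positivity) hx
  have hlog := log_ge_of_ge_pow hL hx
  -- `x^{0.99} = x^{0.8} x^{0.19}`
  have hsplit : x ^ (0.99 : ℝ) = x ^ (0.8 : ℝ) * x ^ (0.19 : ℝ) := by
    rw [← Real.rpow_add hx0]; norm_num
  -- `x^{0.8} ≥ 𝓛⁴¹⁵`
  have h08 : L ^ 415 ≤ x ^ (0.8 : ℝ) := by
    have h1 : (L ^ 519) ^ (0.8 : ℝ) ≤ x ^ (0.8 : ℝ) :=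
      Real.rpow_le_rpow (by positivity) hx (by norm_num)
    refine le_trans ?_ h1
    rw [← Real.rpow_natCast_mul hL0.le]
    calc L ^ 415 = L ^ (415 : ℝ) := by norm_num
      _ ≤ L ^ ((519 : ℕ) * (0.8 : ℝ)) := Real.rpow_le_rpow_of_exponent_le hL1 (by norm_num)
  -- `x^{0.19} ≥ 0.19 log x` and `≥ 1`
  have h019a : 0.19 * Real.log x ≤ x ^ (0.19 : ℝ) := by
    have := Real.log_le_rpow_div hx0.le (by norm_num : (0:ℝ) < 0.19)
    rw [le_div_iff₀ (by norm_num)] at this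
    linarith
  have h019b : 1 ≤ x ^ (0.19 : ℝ) := Real.one_le_rpow (by
    have : (1:ℝ) ≤ L ^ 519 := one_le_pow₀ hL1
    linarith) (by norm_num)
  have h415pos : 0 < L ^ 415 := by positivity
  -- `2 x^{0.99} ≥ 𝓛⁴¹⁵ (0.19 log x + 1)`
  have hmain : L ^ 415 * (0.19 * Real.log x + 1) ≤ 2 * x ^ (0.99 : ℝ) := by
    rw [hsplit]
    have hx08 : 0 ≤ x ^ (0.8 : ℝ) := by positivity
    nlinarith [mul_le_mul h08 h019a (by nlinarith) hx08, mul_le_mul h08 h019b zero_le_one hx08]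
  -- compare with `6(log x + 5𝓛⁹)𝓛⁴⁰⁰`
  have h15 : (32768 : ℝ) ≤ L ^ 15 := by
    calc (32768 : ℝ) = 2 ^ 15 := by norm_num
      _ ≤ L ^ 15 := pow_le_pow_left₀ (by norm_num) hL 15
  have h6 : (64 : ℝ) ≤ L ^ 6 := by
    calc (64 : ℝ) = 2 ^ 6 := by norm_num
      _ ≤ L ^ 6 := pow_le_pow_left₀ (by norm_num) hL 6
  have h415a : L ^ 415 = L ^ 400 * L ^ 15 := by rw [← pow_add]
  have h415b : L ^ 415 = L ^ 409 * L ^ 6 := by rw [← pow_add]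
  have h409 : L ^ 409 = L ^ 400 * L ^ 9 := by rw [← pow_add]
  rw [le_div_iff₀ (by positivity)]
  have hlx0 : 0 ≤ Real.log x := by linarith
  have h400 : 0 ≤ L ^ 400 := by positivity
  -- 6(log x + 5L⁹)L⁴⁰⁰ = 6 L⁴⁰⁰ log x + 30 L⁴⁰⁹ ≤ (L⁴¹⁵·0.19 log x + L⁴¹⁵)/2 ≤ x^{0.99}
  nlinarith [mul_le_mul_of_nonneg_left h15 (mul_nonneg h400 hlx0),
    mul_le_mul_of_nonneg_left h6 (by positivity : (0:ℝ) ≤ L ^ 409)]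

/-! ## Parameter facts -/

/-- `t₀^{1.02} ≤ 𝓛⁵³⁰` and `t₀ ≤ t₀^{1.02}` (`t₀ = 𝓛⁵¹⁹`, `𝓛 ≥ 1`). [cite: Zhang2022LandauSiegel, §2 (2.8)] -/
theorem t0_rpow_bounds {D : ℕ} (hℓ : 1 ≤ ell D) :
    t0 D ≤ t0 D ^ (1.02 : ℝ) ∧ t0 D ^ (1.02 : ℝ) ≤ ell D ^ 530 := by
  have hL0 : 0 ≤ ell D := by linarith
  have ht1 : 1 ≤ t0 D := by rw [t0]; exact one_le_pow₀ hℓ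
  constructor
  · calc t0 D = t0 D ^ (1 : ℝ) := (Real.rpow_one _).symm
      _ ≤ t0 D ^ (1.02 : ℝ) := Real.rpow_le_rpow_of_exponent_le ht1 (by norm_num)
  · rw [t0, ← Real.rpow_natCast_mul hL0]
    calc ell D ^ ((519 : ℕ) * (1.02 : ℝ)) ≤ ell D ^ (530 : ℝ) :=
          Real.rpow_le_rpow_of_exponent_le hℓ (by norm_num)
      _ = ell D ^ 530 := by norm_num

/-- `‖ω(1/2 + 2πix)‖ ≤ 2` (`= (√π/𝓛₂)e^{−(π(x−t₀)/𝓛₂)²}`, `𝓛₂ = 𝓛⁴⁰⁰ ≥ 1`).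
[cite: Zhang2022LandauSiegel, §5 p.25 (Note before Lemma 5.3)] -/
theorem norm_omegaW_half_le {D : ℕ} (hℓ : 1 ≤ ell D) (x : ℝ) :
    ‖omegaW D (1 / 2 + 2 * π * x * I)‖ ≤ 2 := by
  have hL2 : 0 < ell2 D := by rw [ell2]; positivity
  have hL21 : 1 ≤ ell2 D := by rw [ell2]; exact one_le_pow₀ hℓ
  have h : omegaW D (1 / 2 + 2 * π * x * I) =
      (SmoothWeight.omegaLine (ell2 D) (t0 D) x : ℂ) := by
    rw [omegaW, SmoothWeight.omega_half_eq hL2.ne']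
  rw [h, Complex.norm_real, Real.norm_of_nonneg (SmoothWeight.omegaLine_pos hL2 _ _).le,
    SmoothWeight.omegaLine_def]
  have hsqrt : Real.sqrt π ≤ 2 := by
    rw [Real.sqrt_le_left (by norm_num)]
    nlinarith [Real.pi_lt_d2]
  have hexp : Real.exp (-(π * (x - t0 D) / ell2 D) ^ 2) ≤ 1 :=
    Real.exp_le_one_iff.mpr (by nlinarith [sq_nonneg (π * (x - t0 D) / ell2 D)])
  calc Real.sqrt π / ell2 D * Real.exp (-(π * (x - t0 D) / ell2 D) ^ 2)
      ≤ 2 / 1 * 1 := by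
        gcongr
    _ = 2 := by norm_num

/-! ## Pointwise bounds for `d(l)⁴‖Δ(l/X)‖` from Lemma 5.3 -/

/-- **Head range** (`0 < x ≤ t₀^{1.02}`, (5.8)): `‖Δ(x)‖ ≤ 2C + 3` (`‖ω‖ ≤ 2`, `α ≤ 1`, `ε ≤ 1`).
[cite: Zhang2022LandauSiegel, §5 Lemma 5.3 (5.8)] -/
theorem norm_DeltaW_le_head {D : ℕ} {c C : ℝ} (hc : 0 ≤ c) (hC : 0 ≤ C) (hℓ : 2 ≤ ell D) {x : ℝ}
    (h58 : ‖DeltaW D x - omegaW D (1 / 2 + 2 * π * x * I)‖ ≤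
      C * alpha D * ‖omegaW D (1 / 2 + 2 * π * x * I)‖ + Real.exp (-c * ell D ^ 10)) :
    ‖DeltaW D x‖ ≤ 2 * C + 3 := by
  have hℓ1 : 1 ≤ ell D := by linarith
  have hω := norm_omegaW_half_le hℓ1 x
  have hαeq : alpha D = π / ell D ^ 9 := by rw [alpha, bigP, Real.log_exp]
  have hα : alpha D ≤ 1 := by
    rw [hαeq, div_le_one (by positivity)]
    calc π ≤ 4 := Real.pi_lt_four.le
      _ ≤ 2 ^ 9 := by norm_num
      _ ≤ ell D ^ 9 := pow_le_pow_left₀ (by norm_num) hℓ 9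
  have hα0 : 0 ≤ alpha D := by
    rw [hαeq]; positivity
  have hε : Real.exp (-c * ell D ^ 10) ≤ 1 := Real.exp_le_one_iff.mpr (by
    have : 0 ≤ ell D ^ 10 := by positivity
    nlinarith)
  have h1 : ‖DeltaW D x‖ ≤ ‖omegaW D (1 / 2 + 2 * π * x * I)‖ +
      ‖DeltaW D x - omegaW D (1 / 2 + 2 * π * x * I)‖ := by
    have := norm_add_le (omegaW D (1 / 2 + 2 * π * x * I)) (DeltaW D x - omegaW D (1 / 2 + 2 * π * x * I))
    rwa [add_sub_cancel] at this
  have h2 : C * alpha D * ‖omegaW D (1 / 2 + 2 * π * x * I)‖ ≤ C * 1 * 2 := by gcongr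
  linarith

/-- **Tail range** (`x = l/X > t₀^{1.02}`, (5.9)): for `1 ≤ X` with `log X ≤ 5𝓛⁹` and `𝓛 ≥ 2`,
both exponents of (5.9) exceed `6 log l`, so `d(l)⁴‖Δ(l/X)‖ ≤ l⁴ · 2C l⁻⁶ = 2C/l²`.
[cite: Zhang2022LandauSiegel, §5 Lemma 5.3 (5.9)] -/
theorem divisors_pow_mul_norm_DeltaW_le_tail {D : ℕ} {C : ℝ} (hC : 0 ≤ C) (hℓ : 2 ≤ ell D)
    {X : ℝ} (hX1 : 1 ≤ X) (hX5 : Real.log X ≤ 5 * ell D ^ 9) {l : ℕ}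
    (hl : X * t0 D ^ (1.02 : ℝ) < l)
    (h59 : ‖DeltaW D ((l : ℝ) / X)‖ ≤ C * (Real.exp (-((1 : ℝ) / 100 * ell2 D * Real.log ((l : ℝ) / X)) ^ 2) +
      Real.exp (-(((l : ℝ) / X) ^ (0.99 : ℝ)) / ell2 D))) :
    (l.divisors.card : ℝ) ^ 4 * ‖DeltaW D ((l : ℝ) / X)‖ ≤ 2 * C / (l : ℝ) ^ 2 := by
  have hℓ1 : 1 ≤ ell D := by linarith
  obtain ⟨ht0, _⟩ := t0_rpow_bounds hℓ1
  have hX0 : 0 < X := by linarith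
  set x : ℝ := (l : ℝ) / X with hx
  -- `x ≥ 𝓛⁵¹⁹`
  have hx519 : ell D ^ 519 ≤ x := by
    rw [hx, le_div_iff₀ hX0]
    have : ell D ^ 519 * X ≤ X * t0 D ^ (1.02 : ℝ) := by
      rw [mul_comm]; rw [t0] at ht0; exact mul_le_mul_of_nonneg_left ht0 hX0.le
    linarith
  have hx0 : 0 < x := lt_of_lt_of_le (by positivity) hx519
  have hl0 : (0 : ℝ) < l := by
    have : 0 < (l : ℝ) / X := hx0
    exact (div_pos_iff_of_pos_right hX0).mp this
  -- `log l = log x + log X ≤ log x + 5𝓛⁹`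
  have hlogl : Real.log l = Real.log x + Real.log X := by
    rw [hx, Real.log_div hl0.ne' hX0.ne']; ring
  have hlog6 : 6 * Real.log l ≤ 6 * (Real.log x + 5 * ell D ^ 9) := by rw [hlogl]; linarith
  -- the two exponent bounds
  have hE1 : 6 * Real.log l ≤ ((1 : ℝ) / 100 * ell2 D * Real.log x) ^ 2 := by
    rw [ell2]; exact hlog6.trans (six_log_le_gaussLog hℓ hx519)
  have hE2 : 6 * Real.log l ≤ x ^ (0.99 : ℝ) / ell2 D := by
    rw [ell2]; exact hlog6.trans (six_log_le_rpow_div hℓ hx519)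
  -- `exp(-E) ≤ l⁻⁶`
  have hl6 : Real.exp (-(6 * Real.log l)) = ((l : ℝ) ^ 6)⁻¹ := by
    rw [Real.exp_neg, show (6 : ℝ) * Real.log l = Real.log ((l : ℝ) ^ 6) by
      rw [Real.log_pow]; norm_num, Real.exp_log (by positivity)]
  have he1 : Real.exp (-((1 : ℝ) / 100 * ell2 D * Real.log x) ^ 2) ≤ ((l : ℝ) ^ 6)⁻¹ := by
    rw [← hl6]; exact Real.exp_le_exp.mpr (by linarith)
  have he2 : Real.exp (-(x ^ (0.99 : ℝ)) / ell2 D) ≤ ((l : ℝ) ^ 6)⁻¹ := by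
    rw [← hl6, neg_div]; exact Real.exp_le_exp.mpr (by linarith)
  have hΔ : ‖DeltaW D x‖ ≤ C * (2 * ((l : ℝ) ^ 6)⁻¹) :=
    h59.trans (mul_le_mul_of_nonneg_left (by linarith) hC)
  have hd : (l.divisors.card : ℝ) ^ 4 ≤ (l : ℝ) ^ 4 := by
    gcongr
    exact_mod_cast Nat.card_divisors_le_self l
  have hl6pos : 0 < (l : ℝ) ^ 6 := by positivity
  calc (l.divisors.card : ℝ) ^ 4 * ‖DeltaW D x‖ ≤ (l : ℝ) ^ 4 * (C * (2 * ((l : ℝ) ^ 6)⁻¹)) := by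
        gcongr
    _ = 2 * C / (l : ℝ) ^ 2 := by
        field_simp

/-! ## The window lemma: `Σ_l d(l)⁴‖Δ(l/X)‖ ≤ K·X·𝓛⁶⁷⁴` -/

/-- **Σ_l d(l)⁴|Δ(l/X)| ≪ X𝓛⁶⁷⁴**: for `𝓛 ≥ 3`, Lemma 5.3 at `D` (both ranges, constants `c ≥ 0`,
`C ≥ 0`) and `1 ≤ X` with `log X ≤ 5𝓛⁹`, the series `Σ_{l≥0} d(l)⁴‖Δ(l/X)‖` converges and is
`≤ ((2C+3)·7¹⁶ + 4C)·X·𝓛⁶⁷⁴` (head `l ≤ Xt₀^{1.02} ≤ X𝓛⁵³⁰` by `‖Δ‖ ≤ 2C+3` and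
`Σ_{l≤Y} d(l)⁴ ≤ Y(1 + log Y)¹⁶ ≤ Y·(7𝓛⁹)¹⁶`; tail by `2C/l²`, `Σ 1/l² = π²/6 ≤ 2`). This is the
"by Lemma 5.3" of u013 made quantitative. [cite: Zhang2022LandauSiegel, §14 u013 p.78; §5 Lemma 5.3 p.25] -/
theorem tsum_divisors_pow_mul_norm_DeltaW_le {D : ℕ} {c C : ℝ} (hc : 0 ≤ c) (hC : 0 ≤ C)
    (hℓ : 3 ≤ ell D)
    (h53 : ∀ x : ℝ, 0 < x →
      (x ≤ t0 D ^ (1.02 : ℝ) → ‖DeltaW D x - omegaW D (1 / 2 + 2 * π * x * I)‖ ≤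
          C * alpha D * ‖omegaW D (1 / 2 + 2 * π * x * I)‖ + Real.exp (-c * ell D ^ 10)) ∧
      (t0 D ^ (1.02 : ℝ) < x → ‖DeltaW D x‖ ≤
        C * (Real.exp (-((1 : ℝ) / 100 * ell2 D * Real.log x) ^ 2) +
          Real.exp (-(x ^ (0.99 : ℝ)) / ell2 D))))
    {X : ℝ} (hX1 : 1 ≤ X) (hX5 : Real.log X ≤ 5 * ell D ^ 9) :
    Summable (fun l : ℕ => (l.divisors.card : ℝ) ^ 4 * ‖DeltaW D ((l : ℝ) / X)‖) ∧
      ∑' l : ℕ, (l.divisors.card : ℝ) ^ 4 * ‖DeltaW D ((l : ℝ) / X)‖ ≤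
        ((2 * C + 3) * 7 ^ 16 + 4 * C) * X * ell D ^ 674 := by
  have hℓ1 : 1 ≤ ell D := by linarith
  have hℓ2 : 2 ≤ ell D := by linarith
  have hX0 : 0 < X := by linarith
  obtain ⟨_, hY530⟩ := t0_rpow_bounds hℓ1
  set Y₀ : ℝ := t0 D ^ (1.02 : ℝ) with hY₀
  have hY0 : 0 ≤ Y₀ := by rw [hY₀]; exact Real.rpow_nonneg (by rw [t0]; positivity) _
  set L₀ : ℕ := ⌊X * Y₀⌋₊ with hL₀
  set M : ℝ := 2 * C + 3 with hM
  have hM0 : 0 ≤ M := by rw [hM]; positivity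
  set f : ℕ → ℝ := fun l => (l.divisors.card : ℝ) ^ 4 * ‖DeltaW D ((l : ℝ) / X)‖ with hf
  set g₁ : ℕ → ℝ := fun l => if l ≤ L₀ then M * (l.divisors.card : ℝ) ^ 4 else 0 with hg₁
  set g₂ : ℕ → ℝ := fun l => 2 * C * (1 / (l : ℝ) ^ 2) with hg₂
  -- pointwise domination
  have hfg : ∀ l : ℕ, f l ≤ g₁ l + g₂ l := by
    intro l
    have hg₂0 : 0 ≤ g₂ l := by rw [hg₂]; positivity
    rcases Nat.eq_zero_or_pos l with rfl | hlpos
    · simp [hf, hg₁, hg₂]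
    by_cases hle : l ≤ L₀
    · -- head
      have hx0 : 0 < (l : ℝ) / X := by positivity
      have hxY : (l : ℝ) / X ≤ Y₀ := by
        rw [div_le_iff₀ hX0]
        have : (l : ℝ) ≤ L₀ := by exact_mod_cast hle
        exact this.trans ((Nat.floor_le (mul_nonneg hX0.le hY0)).trans (le_of_eq (by ring)))
      have hΔ := norm_DeltaW_le_head hc hC hℓ2 ((h53 _ hx0).1 hxY)
      have : f l ≤ M * (l.divisors.card : ℝ) ^ 4 := by
        rw [hf, hM]
        calc (l.divisors.card : ℝ) ^ 4 * ‖DeltaW D ((l : ℝ) / X)‖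
            ≤ (l.divisors.card : ℝ) ^ 4 * (2 * C + 3) := by gcongr
          _ = (2 * C + 3) * (l.divisors.card : ℝ) ^ 4 := by ring
      rw [hg₁]; simp only [hle, if_true]; linarith
    · -- tail
      have hlt : X * Y₀ < l := by
        have : L₀ < l := lt_of_not_ge hle
        exact (Nat.floor_lt (mul_nonneg hX0.le hY0)).mp this
      have hxY : Y₀ < (l : ℝ) / X := by rw [lt_div_iff₀ hX0]; linarith
      have hx0 : 0 < (l : ℝ) / X := by positivity
      have htail := divisors_pow_mul_norm_DeltaW_le_tail hC hℓ2 hX1 hX5 hlt ((h53 _ hx0).2 hxY)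
      have : f l ≤ g₂ l := by
        rw [hf, hg₂]
        calc _ ≤ 2 * C / (l : ℝ) ^ 2 := htail
          _ = 2 * C * (1 / (l : ℝ) ^ 2) := by ring
      rw [hg₁]; simp only [hle, if_false]; linarith
  have hf0 : ∀ l, 0 ≤ f l := fun l => by rw [hf]; positivity
  -- summability
  have hg₁s : Summable g₁ := by
    refine summable_of_ne_finset_zero (s := Finset.range (L₀ + 1)) fun l hl => ?_
    rw [Finset.mem_range, not_lt] at hl
    rw [hg₁]; simp only [show ¬ l ≤ L₀ by omega, if_false]
  have hg₂s : Summable g₂ := by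
    rw [hg₂]; exact (Real.summable_one_div_nat_pow.mpr one_lt_two).mul_left (2 * C)
  have hgs : Summable (fun l => g₁ l + g₂ l) := hg₁s.add hg₂s
  have hfs : Summable f := Summable.of_nonneg_of_le hf0 hfg hgs
  refine ⟨hfs, ?_⟩
  -- the sum of g₁
  have hg₁sum : ∑' l, g₁ l = ∑ l ∈ Finset.range (L₀ + 1), M * (l.divisors.card : ℝ) ^ 4 := by
    rw [tsum_eq_sum (s := Finset.range (L₀ + 1))]
    · refine Finset.sum_congr rfl fun l hl => ?_
      rw [Finset.mem_range] at hl
      rw [hg₁]; simp only [show l ≤ L₀ by omega, if_true]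
    · intro l hl
      rw [Finset.mem_range, not_lt] at hl
      rw [hg₁]; simp only [show ¬ l ≤ L₀ by omega, if_false]
  have hdivsum : ∑ l ∈ Finset.range (L₀ + 1), (l.divisors.card : ℝ) ^ 4 ≤
      (L₀ : ℝ) * (1 + Real.log L₀) ^ 16 := by
    rw [Finset.range_eq_Ico, ← Finset.insert_Ico_add_one_left_eq_Ico (Nat.zero_lt_succ L₀),
      Finset.sum_insert (by simp), Nat.divisors_zero, Finset.card_empty, Nat.cast_zero,
      zero_pow (by norm_num), zero_add]
    have hIco : Finset.Ico (0 + 1) (L₀ + 1) = Finset.Icc 1 L₀ := by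
      ext l; simp only [Finset.mem_Ico, Finset.mem_Icc]; omega
    rw [hIco]
    have key := sum_card_divisors_pow_div_le_log_pow 4 L₀
    calc ∑ l ∈ Finset.Icc 1 L₀, (l.divisors.card : ℝ) ^ 4
        ≤ ∑ l ∈ Finset.Icc 1 L₀, (L₀ : ℝ) * ((l.divisors.card : ℝ) ^ 4 / l) := by
          refine Finset.sum_le_sum fun l hl => ?_
          obtain ⟨hl1, hl2⟩ := Finset.mem_Icc.mp hl
          have hl0 : (0 : ℝ) < l := by exact_mod_cast hl1
          have hlL : (l : ℝ) ≤ L₀ := by exact_mod_cast hl2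
          rw [mul_div_assoc', le_div_iff₀ hl0]
          nlinarith [pow_nonneg (Nat.cast_nonneg (l.divisors.card) : (0:ℝ) ≤ _) 4]
      _ = (L₀ : ℝ) * ∑ l ∈ Finset.Icc 1 L₀, (l.divisors.card : ℝ) ^ 4 / l := by
          rw [Finset.mul_sum]
      _ ≤ (L₀ : ℝ) * (1 + Real.log L₀) ^ 16 := by
          gcongr
          simpa using key
  -- size of `L₀` and `log L₀`
  have hL₀le : (L₀ : ℝ) ≤ X * ell D ^ 530 := by
    refine (Nat.floor_le (mul_nonneg hX0.le hY0)).trans ?_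
    exact mul_le_mul_of_nonneg_left hY530 hX0.le
  have hlogL₀ : 1 + Real.log L₀ ≤ 7 * ell D ^ 9 := by
    have h9 : (1 : ℝ) ≤ ell D ^ 9 := one_le_pow₀ hℓ1
    rcases Nat.eq_zero_or_pos L₀ with h0 | hpos
    · rw [h0, Nat.cast_zero, Real.log_zero]; linarith
    · have hL₀pos : (0 : ℝ) < L₀ := by exact_mod_cast hpos
      have h1 : Real.log L₀ ≤ Real.log (X * ell D ^ 530) := Real.log_le_log hL₀pos hL₀le
      rw [Real.log_mul hX0.ne' (by positivity), Real.log_pow] at h1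
      have h2 : Real.log (ell D) ≤ ell D := (Real.log_le_sub_one_of_pos (by linarith)).trans (by linarith)
      have h3 : (530 : ℝ) * ell D ≤ ell D ^ 9 := by
        have : (530 : ℝ) ≤ ell D ^ 8 := by
          calc (530 : ℝ) ≤ 3 ^ 8 := by norm_num
            _ ≤ ell D ^ 8 := pow_le_pow_left₀ (by norm_num) hℓ 8
        calc (530 : ℝ) * ell D ≤ ell D ^ 8 * ell D := by gcongr
          _ = ell D ^ 9 := by ring
      push_cast at h1
      nlinarith
  have hsum2 : ∑' l : ℕ, (1 : ℝ) / (l : ℝ) ^ 2 ≤ 2 := by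
    rw [hasSum_zeta_two.tsum_eq]
    nlinarith [Real.pi_lt_d2, Real.pi_pos]
  -- assemble
  have h674 : X * ell D ^ 530 * (7 * ell D ^ 9) ^ 16 = 7 ^ 16 * X * ell D ^ 674 := by ring
  have hX674 : (1 : ℝ) ≤ X * ell D ^ 674 := by
    have : (1 : ℝ) ≤ ell D ^ 674 := one_le_pow₀ hℓ1
    nlinarith
  calc ∑' l, f l ≤ ∑' l, (g₁ l + g₂ l) := hfs.tsum_le_tsum hfg hgs
    _ = ∑' l, g₁ l + ∑' l, g₂ l := hg₁s.tsum_add hg₂s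
    _ = M * ∑ l ∈ Finset.range (L₀ + 1), (l.divisors.card : ℝ) ^ 4 +
          2 * C * ∑' l : ℕ, (1 : ℝ) / (l : ℝ) ^ 2 := by
        rw [hg₁sum, ← Finset.mul_sum, hg₂, tsum_mul_left]
    _ ≤ M * ((L₀ : ℝ) * (1 + Real.log L₀) ^ 16) + 2 * C * 2 := by gcongr
    _ ≤ M * (X * ell D ^ 530 * (7 * ell D ^ 9) ^ 16) + 4 * C * (X * ell D ^ 674) := by
        have h1 : (L₀ : ℝ) * (1 + Real.log L₀) ^ 16 ≤ X * ell D ^ 530 * (7 * ell D ^ 9) ^ 16 := by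
          have hlog0 : 0 ≤ 1 + Real.log L₀ := by
            rcases Nat.eq_zero_or_pos L₀ with h0 | hpos
            · rw [h0, Nat.cast_zero, Real.log_zero]; norm_num
            · have : 0 ≤ Real.log (L₀ : ℝ) := Real.log_natCast_nonneg _
              linarith
          gcongr
        nlinarith [mul_le_mul_of_nonneg_left h1 hM0]
    _ = ((2 * C + 3) * 7 ^ 16 + 4 * C) * X * ell D ^ 674 := by rw [h674, hM]; ring

/-! ## The `l`-series at fixed `d, k` -/

/-- `Dk/φ(Dk) ≤ 9𝓛¹⁸` when `log k ≤ 𝓛⁹` and `𝓛 = log D ≥ 1` (from the tree's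
`Sieve.natCast_div_totient_le`: `n/φ(n) ≤ (1 + log n)²`). [folklore] -/
private theorem natCast_mul_div_totient_le {D k : ℕ} (hℓ1 : 1 ≤ ell D) (hD0 : (0 : ℝ) < D)
    (hk0 : (0 : ℝ) < k) (hlogk : Real.log k ≤ ell D ^ 9) :
    ((D * k : ℕ) : ℝ) / Nat.totient (D * k) ≤ 9 * ell D ^ 18 := by
  refine (Literature.NumberTheory.Sieve.natCast_div_totient_le (D * k)).trans ?_
  have h1 : Real.log ((D * k : ℕ) : ℝ) ≤ 2 * ell D ^ 9 := by
    push_cast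
    rw [Real.log_mul hD0.ne' hk0.ne']
    have h5 : ell D ≤ ell D ^ 9 := le_self_pow₀ hℓ1 (by norm_num)
    have : Real.log (D : ℝ) = ell D := rfl
    linarith
  have h0 : 0 ≤ 1 + Real.log ((D * k : ℕ) : ℝ) := by
    have : 0 ≤ Real.log ((D * k : ℕ) : ℝ) := Real.log_natCast_nonneg _; linarith
  have h9 : (1 : ℝ) ≤ ell D ^ 9 := one_le_pow₀ hℓ1
  nlinarith

/-- **The `l`-series of the majorant at fixed `d, k`**: under (14.1)–(14.2) and Lemma 5.3 at `D`
(`𝓛 ≥ 3`), for `p < 2P` and `1 ≤ k ≤ P`,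
`Σ_l |κ*(dl)a*(dk)|/(φ(Dk)k)·|Δ(l/(Dpk))| ≤ B²·K_W·𝓛⁶⁷⁴·p·9𝓛¹⁸·d(d)⁴/k`
(`K_W = (2C+3)7¹⁶ + 4C`; window lemma at `X = Dpk`). [cite: Zhang2022LandauSiegel, §14 u013 p.78] -/
theorem tsum_majorant_inner_le {D : ℕ} [NeZero D] {c C : ℝ} (hc : 0 ≤ c) (hC : 0 ≤ C)
    (hℓ3 : 3 ≤ ell D)
    (h53 : ∀ x : ℝ, 0 < x →
      (x ≤ t0 D ^ (1.02 : ℝ) → ‖DeltaW D x - omegaW D (1 / 2 + 2 * π * x * I)‖ ≤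
          C * alpha D * ‖omegaW D (1 / 2 + 2 * π * x * I)‖ + Real.exp (-c * ell D ^ 10)) ∧
      (t0 D ^ (1.02 : ℝ) < x → ‖DeltaW D x‖ ≤
        C * (Real.exp (-((1 : ℝ) / 100 * ell2 D * Real.log x) ^ 2) +
          Real.exp (-(x ^ (0.99 : ℝ)) / ell2 D))))
    {B : ℝ} (hB0 : 0 ≤ B) {κs as : ℕ → ℂ} (h141 : Eq141 B κs) (h142 : Eq142 D B as)
    {p : ℕ} (hp1 : (1 : ℝ) ≤ p) (hp2P : (p : ℝ) < 2 * bigP D) {d k : ℕ} (hk1 : 1 ≤ k)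
    (hkP : (k : ℝ) ≤ bigP D) :
    (∑' l : ℕ, ‖κs (d * l) * as (d * k)‖ / ((Nat.totient (D * k) : ℝ) * k) *
        ‖DeltaW D ((l : ℝ) / ((D : ℝ) * p * k))‖) ≤
      B ^ 2 * ((2 * C + 3) * 7 ^ 16 + 4 * C) * ell D ^ 674 * p * (9 * ell D ^ 18) *
        ((d.divisors.card : ℝ) ^ 4 / k) := by
  have hℓ1 : 1 ≤ ell D := by linarith
  have hD0 : (0 : ℝ) < D := by exact_mod_cast Nat.pos_of_ne_zero (NeZero.ne D)
  have hD1 : (1 : ℝ) ≤ D := by exact_mod_cast Nat.pos_of_ne_zero (NeZero.ne D)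
  have hP0 : 0 < bigP D := Real.exp_pos _
  have hlogP : Real.log (bigP D) = ell D ^ 9 := by rw [bigP, Real.log_exp]
  have hk0 : (0 : ℝ) < k := by exact_mod_cast hk1
  have hk1r : (1 : ℝ) ≤ k := by exact_mod_cast hk1
  have hDk0 : 0 < D * k := Nat.mul_pos (Nat.pos_of_ne_zero (NeZero.ne D)) hk1
  have hφ0 : (0 : ℝ) < Nat.totient (D * k) := by exact_mod_cast Nat.totient_pos.mpr hDk0
  have hlogk : Real.log k ≤ ell D ^ 9 := by rw [← hlogP]; exact Real.log_le_log hk0 hkP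
  set W : ℝ := (2 * C + 3) * 7 ^ 16 + 4 * C with hW
  set X : ℝ := (D : ℝ) * p * k with hX
  have hX1 : 1 ≤ X := by
    rw [hX]
    have h1 : (1 : ℝ) ≤ (D : ℝ) * p := by nlinarith
    nlinarith
  have hX0 : 0 < X := by linarith
  have hlogX : Real.log X ≤ 5 * ell D ^ 9 := by
    rw [hX, Real.log_mul (by positivity) hk0.ne', Real.log_mul hD0.ne' (by linarith)]
    have h1 : Real.log D = ell D := rfl
    have h2 : Real.log p ≤ Real.log 2 + ell D ^ 9 := by
      rw [← hlogP, ← Real.log_mul (by norm_num) hP0.ne']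
      exact Real.log_le_log (by linarith) hp2P.le
    have h4 : Real.log 2 ≤ 1 := by
      have := Real.log_two_lt_d9; linarith
    have h5 : ell D ≤ ell D ^ 9 := le_self_pow₀ hℓ1 (by norm_num)
    rw [h1]; linarith
  obtain ⟨hsum, hwin⟩ := tsum_divisors_pow_mul_norm_DeltaW_le hc hC hℓ3 h53 hX1 hlogX
  -- pointwise domination of the summand
  set A : ℝ := B ^ 2 * (d.divisors.card : ℝ) ^ 4 / ((Nat.totient (D * k) : ℝ) * k) with hA
  have hA0 : 0 ≤ A := by rw [hA]; positivity
  have hpt : ∀ l : ℕ, ‖κs (d * l) * as (d * k)‖ / ((Nat.totient (D * k) : ℝ) * k) *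
      ‖DeltaW D ((l : ℝ) / X)‖ ≤ A * ((l.divisors.card : ℝ) ^ 4 * ‖DeltaW D ((l : ℝ) / X)‖) := by
    intro l
    have hκ : ‖κs (d * l)‖ ≤ B * ((d.divisors.card : ℝ) ^ 4 * (l.divisors.card : ℝ) ^ 4) := by
      refine (h141 (d * l)).trans (mul_le_mul_of_nonneg_left ?_ hB0)
      refine (zeta_pow_five_le_card_divisors_pow_four (d * l)).trans ?_
      rw [← mul_pow]
      gcongr
      exact_mod_cast card_divisors_mul_le d l
    have ha : ‖as (d * k)‖ ≤ B := h142.1 _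
    have hprod : ‖κs (d * l) * as (d * k)‖ ≤
        B ^ 2 * (d.divisors.card : ℝ) ^ 4 * (l.divisors.card : ℝ) ^ 4 := by
      rw [norm_mul]
      calc ‖κs (d * l)‖ * ‖as (d * k)‖
          ≤ (B * ((d.divisors.card : ℝ) ^ 4 * (l.divisors.card : ℝ) ^ 4)) * B :=
            mul_le_mul hκ ha (norm_nonneg _) (by positivity)
        _ = B ^ 2 * (d.divisors.card : ℝ) ^ 4 * (l.divisors.card : ℝ) ^ 4 := by ring
    have hq0 : (0 : ℝ) < (Nat.totient (D * k) : ℝ) * k := by positivity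
    rw [hA, div_mul_eq_mul_div, div_mul_eq_mul_div, div_le_div_iff_of_pos_right hq0]
    calc ‖κs (d * l) * as (d * k)‖ * ‖DeltaW D ((l : ℝ) / X)‖
        ≤ (B ^ 2 * (d.divisors.card : ℝ) ^ 4 * (l.divisors.card : ℝ) ^ 4) * ‖DeltaW D ((l : ℝ) / X)‖ := by
          gcongr
      _ = _ := by ring
  have hpt0 : ∀ l : ℕ, 0 ≤ ‖κs (d * l) * as (d * k)‖ / ((Nat.totient (D * k) : ℝ) * k) *
      ‖DeltaW D ((l : ℝ) / X)‖ := fun l => by positivity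
  have hmaj : Summable (fun l : ℕ => A * ((l.divisors.card : ℝ) ^ 4 * ‖DeltaW D ((l : ℝ) / X)‖)) :=
    hsum.mul_left A
  have hfs : Summable (fun l : ℕ => ‖κs (d * l) * as (d * k)‖ / ((Nat.totient (D * k) : ℝ) * k) *
      ‖DeltaW D ((l : ℝ) / X)‖) := Summable.of_nonneg_of_le hpt0 hpt hmaj
  have hφ : ((D * k : ℕ) : ℝ) / Nat.totient (D * k) ≤ 9 * ell D ^ 18 :=
    natCast_mul_div_totient_le hℓ1 hD0 hk0 hlogk
  have hAX : A * (W * X * ell D ^ 674) =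
      B ^ 2 * W * ell D ^ 674 * p * (((D * k : ℕ) : ℝ) / Nat.totient (D * k)) *
        ((d.divisors.card : ℝ) ^ 4 / k) := by
    rw [hA, hX]; push_cast
    field_simp
  calc (∑' l : ℕ, ‖κs (d * l) * as (d * k)‖ / ((Nat.totient (D * k) : ℝ) * k) *
        ‖DeltaW D ((l : ℝ) / X)‖)
      ≤ ∑' l : ℕ, A * ((l.divisors.card : ℝ) ^ 4 * ‖DeltaW D ((l : ℝ) / X)‖) :=
        hfs.tsum_le_tsum hpt hmaj
    _ = A * ∑' l : ℕ, (l.divisors.card : ℝ) ^ 4 * ‖DeltaW D ((l : ℝ) / X)‖ := tsum_mul_left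
    _ ≤ A * (W * X * ell D ^ 674) := mul_le_mul_of_nonneg_left hwin hA0
    _ = B ^ 2 * W * ell D ^ 674 * p * (((D * k : ℕ) : ℝ) / Nat.totient (D * k)) *
          ((d.divisors.card : ℝ) ^ 4 / k) := hAX
    _ ≤ B ^ 2 * W * ell D ^ 674 * p * (9 * ell D ^ 18) * ((d.divisors.card : ℝ) ^ 4 / k) := by
        gcongr

/-! ## Summing over `k` and `d` -/

/-- **The `(d,k,l)`-sum of the majorant**: with the inner bound of `tsum_majorant_inner_le`
(abstracted as a hypothesis with constant `W ≥ 0`), `Σ_{k ≤ K} 1/k ≤ 2𝓛⁹` and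
`Σ_{d ≤ K} d(d)⁴/d ≤ 2¹⁶𝓛¹⁴⁴` (`1 + log K ≤ 2𝓛⁹`) give
`major ≤ 18·2¹⁷·B²·W·P·𝓛⁸⁴⁵` when `p < 2P`. [cite: Zhang2022LandauSiegel, §14 u013 p.78] -/
theorem majorant_sum_le {D p K : ℕ} {B W : ℝ} (hW0 : 0 ≤ W) (hℓ1 : 1 ≤ ell D)
    (hp2P : (p : ℝ) < 2 * bigP D) (hlogK1 : 1 + Real.log K ≤ 2 * ell D ^ 9)
    (F : ℕ → ℕ → ℝ)
    (hF : ∀ d ∈ Finset.Icc 1 K, ∀ k ∈ Finset.Icc 1 K,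
      F d k ≤ B ^ 2 * W * ell D ^ 674 * p * (9 * ell D ^ 18) * ((d.divisors.card : ℝ) ^ 4 / k)) :
    ∑ d ∈ Finset.Icc 1 K, (d : ℝ)⁻¹ * ∑ k ∈ Finset.Icc 1 K, F d k ≤
      18 * 2 ^ 17 * B ^ 2 * W * bigP D * ell D ^ 845 := by
  have hlogK0 : 0 ≤ 1 + Real.log K := by
    have : 0 ≤ Real.log (K : ℝ) := Real.log_natCast_nonneg K; linarith
  have hharm : ∑ k ∈ Finset.Icc 1 K, (1 : ℝ) / k ≤ 2 * ell D ^ 9 :=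
    (sum_Icc_one_div_le_one_add_log K).trans hlogK1
  have hP0 : 0 ≤ bigP D := (Real.exp_pos _).le
  -- sum over `k` at fixed `d`
  have hksum : ∀ d ∈ Finset.Icc 1 K,
      ∑ k ∈ Finset.Icc 1 K, F d k ≤ 18 * B ^ 2 * W * p * ell D ^ 701 * (d.divisors.card : ℝ) ^ 4 := by
    intro d hd
    calc ∑ k ∈ Finset.Icc 1 K, F d k
        ≤ ∑ k ∈ Finset.Icc 1 K, B ^ 2 * W * ell D ^ 674 * p * (9 * ell D ^ 18) *
            ((d.divisors.card : ℝ) ^ 4 / k) := Finset.sum_le_sum (hF d hd)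
      _ = B ^ 2 * W * ell D ^ 674 * p * (9 * ell D ^ 18) * (d.divisors.card : ℝ) ^ 4 *
            ∑ k ∈ Finset.Icc 1 K, (1 : ℝ) / k := by
          rw [Finset.mul_sum]
          refine Finset.sum_congr rfl fun k _ => ?_
          ring
      _ ≤ B ^ 2 * W * ell D ^ 674 * p * (9 * ell D ^ 18) * (d.divisors.card : ℝ) ^ 4 *
            (2 * ell D ^ 9) := by gcongr
      _ = 18 * B ^ 2 * W * p * ell D ^ 701 * (d.divisors.card : ℝ) ^ 4 := by ring
  -- sum over `d`
  have hdsum : ∑ d ∈ Finset.Icc 1 K, (d.divisors.card : ℝ) ^ 4 / d ≤ 2 ^ 16 * ell D ^ 144 := by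
    refine (sum_card_divisors_pow_div_le_log_pow 4 K).trans ?_
    calc (1 + Real.log K) ^ (2 ^ 4) = (1 + Real.log K) ^ 16 := by norm_num
      _ ≤ (2 * ell D ^ 9) ^ 16 := pow_le_pow_left₀ hlogK0 hlogK1 16
      _ = 2 ^ 16 * ell D ^ 144 := by ring
  have hd0 : 0 ≤ ∑ d ∈ Finset.Icc 1 K, (d.divisors.card : ℝ) ^ 4 / d :=
    Finset.sum_nonneg fun d _ => by positivity
  have hc0 : 0 ≤ 18 * B ^ 2 * W := by positivity
  calc ∑ d ∈ Finset.Icc 1 K, (d : ℝ)⁻¹ * ∑ k ∈ Finset.Icc 1 K, F d k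
      ≤ ∑ d ∈ Finset.Icc 1 K, (d : ℝ)⁻¹ * (18 * B ^ 2 * W * p * ell D ^ 701 * (d.divisors.card : ℝ) ^ 4) := by
        refine Finset.sum_le_sum fun d hd => ?_
        exact mul_le_mul_of_nonneg_left (hksum d hd) (by positivity)
    _ = 18 * B ^ 2 * W * p * ell D ^ 701 * ∑ d ∈ Finset.Icc 1 K, (d.divisors.card : ℝ) ^ 4 / d := by
        rw [Finset.mul_sum]
        refine Finset.sum_congr rfl fun d _ => ?_
        ring
    _ ≤ 18 * B ^ 2 * W * (2 * bigP D) * ell D ^ 701 * (2 ^ 16 * ell D ^ 144) := by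
        have h1 : 18 * B ^ 2 * W * p ≤ 18 * B ^ 2 * W * (2 * bigP D) :=
          mul_le_mul_of_nonneg_left hp2P.le hc0
        have h2 : 0 ≤ ell D ^ 701 := by positivity
        have h3 : 0 ≤ 18 * B ^ 2 * W * (2 * bigP D) * ell D ^ 701 := by positivity
        calc 18 * B ^ 2 * W * p * ell D ^ 701 * ∑ d ∈ Finset.Icc 1 K, (d.divisors.card : ℝ) ^ 4 / d
            ≤ 18 * B ^ 2 * W * (2 * bigP D) * ell D ^ 701 *
                ∑ d ∈ Finset.Icc 1 K, (d.divisors.card : ℝ) ^ 4 / d :=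
              mul_le_mul_of_nonneg_right (mul_le_mul_of_nonneg_right h1 h2) hd0
          _ ≤ 18 * B ^ 2 * W * (2 * bigP D) * ell D ^ 701 * (2 ^ 16 * ell D ^ 144) :=
              mul_le_mul_of_nonneg_left hdsum h3
    _ = 18 * 2 ^ 17 * B ^ 2 * W * bigP D * (ell D ^ 701 * ell D ^ 144) := by ring
    _ = 18 * 2 ^ 17 * B ^ 2 * W * bigP D * ell D ^ 845 := by rw [← pow_add]

/-! ## `Z22:§14.u013`, second `≪`: the majorant is `≪ P𝓛ᶜ` -/

/-- `Z22:§14.u013` (second `≪`) DISCHARGED: **"[the majorant] `≪ P𝓛ᶜ`, by Lemma 5.3"** (p. 78, tex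
L3930), i.e. `Typed.Sec14.Step14u013b`, UNCONDITIONALLY and for every `B`, with `c = 845` and
`C = 18·2¹⁷·B²·((2C₅₃⁺+3)7¹⁶ + 4C₅₃⁺)` (`C₅₃⁺ = max(C₅₃, 0)`, `C₅₃` the constant of the tree's
discharged Lemma 5.3, `Skeleton.lemma53_holds`): `|κ*(dl)a*(dk)| ≤ B²τ₅(dl) ≤ B²d(d)⁴d(l)⁴`
((14.1)–(14.2)), the window lemma `tsum_divisors_pow_mul_norm_DeltaW_le` at `X = Dpk` (`1 ≤ X`,
`log X ≤ 5𝓛⁹` since `p < 2P`, `k ≤ 2P₄ ≤ P`), `Dk/φ(Dk) ≤ (1 + log Dk)² ≤ 9𝓛¹⁸` (the tree's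
`Sieve.natCast_div_totient_le`), `Σ_{k≤2P₄} 1/k ≤ 2𝓛⁹`, `Σ_{d≤2P₄} d(d)⁴/d ≤ (1 + log 2P₄)¹⁶ ≤ 2¹⁶𝓛¹⁴⁴`
(`sum_card_divisors_pow_div_le_log_pow`). Assumption (A) is not used.
[cite: Zhang2022LandauSiegel, §14 u013 p.78, tex L3930] -/
theorem step14u013b_holds : Step14u013b := by
  intro B
  obtain ⟨c53, hc53, C53, D₅₃, h53⟩ := lemma53_holds
  obtain ⟨D₁, hD₁⟩ := exists_two_mul_P4_le_bigP
  have hC₀0 : 0 ≤ max C53 0 := le_max_right _ _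
  have hW0 : 0 ≤ (2 * max C53 0 + 3) * 7 ^ 16 + 4 * max C53 0 := by positivity
  refine ⟨845, 18 * 2 ^ 17 * B ^ 2 * ((2 * max C53 0 + 3) * 7 ^ 16 + 4 * max C53 0),
    max (max D₅₃ D₁) ⌈Real.exp 3⌉₊, fun D _ χ hD hq hprim _ p hpW κs as h141 h142 => ?_⟩
  have hD₅₃ : D₅₃ ≤ D := le_trans (le_trans (le_max_left _ _) (le_max_left _ _)) hD
  have hD₁' : D₁ ≤ D := le_trans (le_trans (le_max_right _ _) (le_max_left _ _)) hD
  have hD3 : ⌈Real.exp 3⌉₊ ≤ D := le_trans (le_max_right _ _) hD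
  -- `𝓛 ≥ 3`
  have hDe : Real.exp 3 ≤ D := le_trans (Nat.le_ceil _) (by exact_mod_cast hD3)
  have hD0 : (0 : ℝ) < D := lt_of_lt_of_le (Real.exp_pos 3) hDe
  have hℓ3 : 3 ≤ ell D := by rw [ell, Real.le_log_iff_exp_le hD0]; exact hDe
  have hℓ1 : 1 ≤ ell D := by linarith
  -- Lemma 5.3 at `D`, with the nonnegative constant `max C₅₃ 0`
  have h53D : ∀ x : ℝ, 0 < x →
      (x ≤ t0 D ^ (1.02 : ℝ) → ‖DeltaW D x - omegaW D (1 / 2 + 2 * π * x * I)‖ ≤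
          max C53 0 * alpha D * ‖omegaW D (1 / 2 + 2 * π * x * I)‖ + Real.exp (-c53 * ell D ^ 10)) ∧
      (t0 D ^ (1.02 : ℝ) < x → ‖DeltaW D x‖ ≤
        max C53 0 * (Real.exp (-((1 : ℝ) / 100 * ell2 D * Real.log x) ^ 2) +
          Real.exp (-(x ^ (0.99 : ℝ)) / ell2 D))) := by
    intro x hx
    have h := h53 D χ hD₅₃ hq hprim x hx
    have hα0 : 0 ≤ alpha D := by
      rw [alpha, bigP, Real.log_exp]
      exact div_nonneg Real.pi_pos.le (pow_nonneg (Real.log_natCast_nonneg D) 9)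
    have hω0 : 0 ≤ ‖omegaW D (1 / 2 + 2 * π * x * I)‖ := norm_nonneg _
    have he0 : 0 ≤ Real.exp (-((1 : ℝ) / 100 * ell2 D * Real.log x) ^ 2) +
        Real.exp (-(x ^ (0.99 : ℝ)) / ell2 D) := by positivity
    refine ⟨fun hx1 => (h.1 hx1).trans ?_, fun hx2 => (h.2 hx2).trans ?_⟩
    · have : C53 * alpha D * ‖omegaW D (1 / 2 + 2 * π * x * I)‖ ≤
          max C53 0 * alpha D * ‖omegaW D (1 / 2 + 2 * π * x * I)‖ :=
        mul_le_mul_of_nonneg_right (mul_le_mul_of_nonneg_right (le_max_left _ _) hα0) hω0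
      linarith
    · exact mul_le_mul_of_nonneg_right (le_max_left _ _) he0
  -- data of the window
  have hp : p.Prime := (Finset.mem_filter.mp hpW).2
  have hp1 : (1 : ℝ) ≤ p := by exact_mod_cast hp.one_lt.le
  have hp2P : (p : ℝ) < 2 * bigP D := Section7MainTerm.lt_two_mul_bigP_of_mem_primeWindow hℓ1 hpW
  have hP0 : 0 < bigP D := Real.exp_pos _
  have hlogP : Real.log (bigP D) = ell D ^ 9 := by rw [bigP, Real.log_exp]
  have hB0 : 0 ≤ B := (norm_nonneg _).trans (h142.1 0)
  have hKP : (⌊2 * P4 D⌋₊ : ℝ) ≤ bigP D := by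
    have h0 : 0 ≤ 2 * P4 D := by
      have : 0 ≤ P4 D := by
        rw [P4, t0]
        exact mul_nonneg (div_nonneg hP0.le (pow_nonneg (Real.exp_pos _).le 2))
          (pow_nonneg (Real.log_natCast_nonneg D) 519)
      linarith
    exact (Nat.floor_le h0).trans (hD₁ D hD₁')
  have hlogK1 : 1 + Real.log (⌊2 * P4 D⌋₊ : ℕ) ≤ 2 * ell D ^ 9 := by
    have h9 : (1 : ℝ) ≤ ell D ^ 9 := one_le_pow₀ hℓ1
    have hlogK : Real.log (⌊2 * P4 D⌋₊ : ℕ) ≤ ell D ^ 9 := by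
      rcases Nat.eq_zero_or_pos ⌊2 * P4 D⌋₊ with h0 | hpos
      · rw [h0, Nat.cast_zero, Real.log_zero]; positivity
      · rw [← hlogP]; exact Real.log_le_log (by exact_mod_cast hpos) hKP
    linarith
  rw [show ell D ^ (845 : ℝ) = ell D ^ (845 : ℕ) by
    rw [show (845 : ℝ) = ((845 : ℕ) : ℝ) by norm_num, Real.rpow_natCast], major1413]
  refine majorant_sum_le hW0 hℓ1 hp2P hlogK1 _ fun d hd k hk => ?_
  obtain ⟨hk1, hkK⟩ := Finset.mem_Icc.mp hk
  have hkP : (k : ℝ) ≤ bigP D := le_trans (by exact_mod_cast hkK) hKP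
  exact tsum_majorant_inner_le hc53.le hC₀0 hℓ3 h53D hB0 h141 h142 hp1 hp2P hk1 hkP

end Literature.NumberTheory.LFunctions.Zhang2022.Typed.Sec14
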